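import Literature.NumberTheory.Sieve.RankinSmoothNumbers
import Literature.NumberTheory.LFunctions.MertensElementary
import HarnessLib

/-!
# Rankin's smooth-number bound with an explicit Euler-product estimate

Topic `Literature/NumberTheory/Sieve`. Everything in this file is PROVED.

The tree's `Literature.NumberTheory.Sieve.card_smoothNumbersUpTo_le_rankin` (Rankin's method,
Montgomery–Vaughan (7.17)) gives `Ψ(N, k) ≤ N^σ ∏_{p<k} (1 − p^{−σ})⁻¹` for every `σ > 0`. To
USE it with `σ = 1 − η` slightly below `1` — as in Rankin's 1938 gap theorem and in K. S. McCurley,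
*The smallest prime value of `xⁿ + a`*, Can. J. Math. 38 (1986), proof of Theorem 3 (where the
sharper de Bruijn bound `Ψ(x, y) < x exp(−(1 − ε) t log t)`, Lemma 2, is quoted) — one needs a
bound for the Euler product. We prove the elementary Chebyshev–Mertens-quality estimate

  `∏_{p<k} (1 − p^{−(1−η)})⁻¹ ≤ exp(4 ∑_{p<k} p^{−(1−η)})`
  `≤ exp(4 ∑_{p<k} 1/p + 4 η k^η ∑_{p<k} (log p)/p)`          (`0 < η ≤ 1/2`)
  `≤ exp(4 (log log k + 4) + 4 η k^η (log k + 2))`              (`k ≥ 2`),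

using `(1 − v)⁻¹ ≤ e^{4v}` for `0 ≤ v ≤ 3/4`, `p^η ≤ 1 + η (log p) k^η` for `p < k`, and the
tree's elementary Mertens bounds `∑_{p ≤ k} 1/p ≤ log log k + 4`,
`∑_{p ≤ k} (log p)/p ≤ log k + log 4` (`Literature.NumberTheory.LFunctions.MertensBound`). The
resulting `Ψ(N, k) ≤ N^{1−η} exp(4 log log k + 16 + 4 η k^η (log k + 2))` loses only constants in
the exponent against de Bruijn's bound in the range `log k ≍ log N · log₃ N / log₂ N` used by
Rankin and McCurley, which is all that the proof of McCurley's Theorem 3 needs.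

* `inv_one_sub_le_exp_four_mul` : `(1 − v)⁻¹ ≤ exp(4 v)` for `0 ≤ v ≤ 3/4`;
* `prod_primesBelow_inv_one_sub_rpow_le` : the Euler product bound;
* `card_smoothNumbersUpTo_le_rankin_exp` : the displayed bound for `Ψ(N, k)`.

## References

* K. S. McCurley, Can. J. Math. 38 (1986) 925–936, Lemma 2 and §4. [McCurley1986SmallestPrimeValue]
* H. L. Montgomery, R. C. Vaughan, *Multiplicative Number Theory I*, CUP 2007, §7.1. [MontgomeryVaughan2007]
-/

open Finset Real

namespace Literature.NumberTheory.Sieve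

/-! ### Elementary inequalities -/

/-- `(1 − v)⁻¹ ≤ exp(4 v)` for `0 ≤ v ≤ 3/4`: indeed `(1 − v)⁻¹ ≤ exp((1 − v)⁻¹ − 1)` and
`(1 − v)⁻¹ − 1 = v/(1 − v) ≤ 4 v`. [folklore] -/
theorem inv_one_sub_le_exp_four_mul {v : ℝ} (hv0 : 0 ≤ v) (hv : v ≤ 3 / 4) :
    (1 - v)⁻¹ ≤ Real.exp (4 * v) := by
  have h1 : 0 < 1 - v := by linarith
  have h2 : (1 - v)⁻¹ ≤ Real.exp ((1 - v)⁻¹ - 1) := by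
    have := Real.add_one_le_exp ((1 - v)⁻¹ - 1)
    linarith
  refine h2.trans (Real.exp_le_exp.2 ?_)
  rw [inv_eq_one_div, div_sub_one h1.ne', div_le_iff₀ h1]
  nlinarith

/-- For `2 ≤ p`, `p < k` (reals) and `0 ≤ η`: `p^{−(1−η)} ≤ 1/p + η k^η (log p)/p`
(`p^{−(1−η)} = p^η/p` and `p^η = e^{η log p} ≤ 1 + η log p · e^{η log p} ≤ 1 + η log p · k^η`).
[folklore] -/
theorem rpow_neg_one_sub_le {p k η : ℝ} (hp : 2 ≤ p) (hpk : p ≤ k) (hη : 0 ≤ η) :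
    p ^ (-(1 - η)) ≤ 1 / p + η * k ^ η * (Real.log p / p) := by
  have hp0 : 0 < p := by linarith
  have hk0 : 0 < k := by linarith
  have hlogp : 0 ≤ Real.log p := Real.log_nonneg (by linarith)
  have hpη : p ^ η ≤ k ^ η := Real.rpow_le_rpow hp0.le hpk hη
  have hkη : 0 < k ^ η := Real.rpow_pos_of_pos hk0 η
  -- `p^η ≤ 1 + η log p · k^η`
  have h1 : p ^ η ≤ 1 + η * Real.log p * k ^ η := by
    have hx : 0 ≤ η * Real.log p := mul_nonneg hη hlogp
    -- `e^t ≤ 1 + t e^t` (as in `PairProducts.exp_le_one_add_mul_exp`), `t = η log p`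
    have h : Real.exp (η * Real.log p) ≤ 1 + η * Real.log p * Real.exp (η * Real.log p) := by
      have h0 := Real.add_one_le_exp (-(η * Real.log p))
      have hpos := Real.exp_pos (η * Real.log p)
      have h1 : (-(η * Real.log p) + 1) * Real.exp (η * Real.log p) ≤
          Real.exp (-(η * Real.log p)) * Real.exp (η * Real.log p) :=
        mul_le_mul_of_nonneg_right h0 hpos.le
      rw [← Real.exp_add, neg_add_cancel, Real.exp_zero] at h1
      nlinarith
    rw [Real.rpow_def_of_pos hp0, mul_comm (Real.log p) η]
    calc Real.exp (η * Real.log p) ≤ 1 + η * Real.log p * Real.exp (η * Real.log p) := h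
      _ ≤ 1 + η * Real.log p * k ^ η := by
          have : Real.exp (η * Real.log p) = p ^ η := by
            rw [Real.rpow_def_of_pos hp0, mul_comm]
          rw [this]
          nlinarith
  have h2 : p ^ (-(1 - η)) = p ^ η / p := by
    rw [show -(1 - η) = η - 1 by ring, Real.rpow_sub_one hp0.ne']
  rw [h2, div_le_iff₀ hp0]
  calc p ^ η ≤ 1 + η * Real.log p * k ^ η := h1
    _ = (1 / p + η * k ^ η * (Real.log p / p)) * p := by field_simp

/-! ### The Euler product for `σ = 1 − η` -/

/-- **Euler product bound.** For `0 < η ≤ 1/2`,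
`∏_{p<k} (1 − p^{−(1−η)})⁻¹ ≤ exp(4 ∑_{p<k} 1/p + 4 η k^η ∑_{p<k} (log p)/p)`: each factor is
`(1 − v)⁻¹ ≤ e^{4v}` with `v = p^{−(1−η)} ≤ 2^{−1/2} ≤ 3/4`, and `v ≤ 1/p + η k^η (log p)/p`.
[folklore] -/
theorem prod_primesBelow_inv_one_sub_rpow_le (k : ℕ) {η : ℝ} (hη0 : 0 < η) (hη : η ≤ 1 / 2) :
    ∏ p ∈ k.primesBelow, (1 - (p : ℝ) ^ (-(1 - η)))⁻¹ ≤
      Real.exp (4 * ∑ p ∈ k.primesBelow, (1 : ℝ) / p +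
        4 * (η * (k : ℝ) ^ η * ∑ p ∈ k.primesBelow, Real.log p / p)) := by
  have hmem : ∀ p ∈ k.primesBelow, p.Prime ∧ p < k := fun p hp =>
    ⟨Nat.prime_of_mem_primesBelow hp, Nat.lt_of_mem_primesBelow hp⟩
  -- the size of each `v = p^{-(1-η)}`
  have hv : ∀ p ∈ k.primesBelow, 0 ≤ (p : ℝ) ^ (-(1 - η)) ∧ (p : ℝ) ^ (-(1 - η)) ≤ 3 / 4 := by
    intro p hp
    have hp2 : (2 : ℝ) ≤ p := by exact_mod_cast (hmem p hp).1.two_le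
    have hp0 : (0 : ℝ) < p := by linarith
    refine ⟨Real.rpow_nonneg hp0.le _, ?_⟩
    -- `p^{-(1-η)} ≤ p^{-1/2} ≤ 2^{-1/2} ≤ 3/4`
    have h1 : (p : ℝ) ^ (-(1 - η)) ≤ (p : ℝ) ^ (-(1 / 2 : ℝ)) :=
      Real.rpow_le_rpow_of_exponent_le (by linarith) (by linarith)
    have h2 : (p : ℝ) ^ (-(1 / 2 : ℝ)) ≤ (2 : ℝ) ^ (-(1 / 2 : ℝ)) :=
      Real.rpow_le_rpow_of_nonpos (by norm_num) hp2 (by norm_num)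
    have h3 : (2 : ℝ) ^ (-(1 / 2 : ℝ)) ≤ 3 / 4 := by
      have hs : (4 / 3 : ℝ) ≤ Real.sqrt 2 := by
        rw [Real.le_sqrt' (by norm_num : (0 : ℝ) < 4 / 3)]
        norm_num
      have hs0 : (0 : ℝ) < Real.sqrt 2 := by positivity
      rw [Real.rpow_neg (by norm_num : (0 : ℝ) ≤ 2), ← Real.sqrt_eq_rpow, inv_le_comm₀ hs0 (by norm_num)]
      calc (3 / 4 : ℝ)⁻¹ = 4 / 3 := by norm_num
        _ ≤ Real.sqrt 2 := hs
    exact h1.trans (h2.trans h3)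
  calc ∏ p ∈ k.primesBelow, (1 - (p : ℝ) ^ (-(1 - η)))⁻¹
      ≤ ∏ p ∈ k.primesBelow, Real.exp (4 * (p : ℝ) ^ (-(1 - η))) := by
        refine prod_le_prod (fun p hp => ?_) fun p hp => ?_
        · have := hv p hp
          exact inv_nonneg.2 (by linarith [this.2])
        · exact inv_one_sub_le_exp_four_mul (hv p hp).1 (hv p hp).2
    _ = Real.exp (4 * ∑ p ∈ k.primesBelow, (p : ℝ) ^ (-(1 - η))) := by
        rw [← Real.exp_sum, mul_sum]
    _ ≤ Real.exp (4 * ∑ p ∈ k.primesBelow, ((1 : ℝ) / p + η * (k : ℝ) ^ η * (Real.log p / p))) := by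
        refine Real.exp_le_exp.2 (mul_le_mul_of_nonneg_left (sum_le_sum fun p hp => ?_) (by norm_num))
        have hp2 : (2 : ℝ) ≤ p := by exact_mod_cast (hmem p hp).1.two_le
        have hpk : (p : ℝ) ≤ k := by exact_mod_cast (hmem p hp).2.le
        exact rpow_neg_one_sub_le hp2 hpk hη0.le
    _ = Real.exp (4 * ∑ p ∈ k.primesBelow, (1 : ℝ) / p +
          4 * (η * (k : ℝ) ^ η * ∑ p ∈ k.primesBelow, Real.log p / p)) := by
        rw [sum_add_distrib, ← mul_sum, mul_add]

/-- The two prime sums over `p < k` are bounded by the tree's elementary Mertens estimates over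
`p ≤ k`: `∑_{p<k} 1/p ≤ log log k + 4` and `∑_{p<k} (log p)/p ≤ log k + 2` (`k ≥ 2`).
[folklore] -/
theorem sum_primesBelow_inv_le_and (k : ℕ) (hk : 2 ≤ k) :
    ∑ p ∈ k.primesBelow, (1 : ℝ) / p ≤ Real.log (Real.log k) + 4 ∧
      ∑ p ∈ k.primesBelow, Real.log p / p ≤ Real.log k + 2 := by
  have hsub : k.primesBelow ⊆ Nat.primesLE k := by
    intro p hp
    exact Nat.mem_primesLE.2 ⟨(Nat.lt_of_mem_primesBelow hp).le, Nat.prime_of_mem_primesBelow hp⟩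
  have hlog4 : Real.log 4 ≤ 2 := by
    have h4 : Real.log 4 = 2 * Real.log 2 := by
      rw [show (4 : ℝ) = 2 ^ 2 by norm_num, Real.log_pow]; ring
    have := Real.log_two_lt_d9
    rw [h4]; linarith
  constructor
  · calc ∑ p ∈ k.primesBelow, (1 : ℝ) / p ≤ ∑ p ∈ Nat.primesLE k, (1 : ℝ) / p :=
          sum_le_sum_of_subset_of_nonneg hsub fun p _ _ => by positivity
      _ ≤ Real.log (Real.log k) + 4 :=
          Literature.NumberTheory.LFunctions.MertensBound.sum_inv_prime_le k hk
  · calc ∑ p ∈ k.primesBelow, Real.log p / p ≤ ∑ p ∈ Nat.primesLE k, Real.log p / p := by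
          refine sum_le_sum_of_subset_of_nonneg hsub fun p hp _ => ?_
          have : (1 : ℝ) ≤ p := by exact_mod_cast (Nat.mem_primesLE.1 hp).2.one_le
          exact div_nonneg (Real.log_nonneg this) (by linarith)
      _ ≤ Real.log k + Real.log 4 :=
          Literature.NumberTheory.LFunctions.MertensBound.sum_log_div_prime_le k
      _ ≤ Real.log k + 2 := by linarith

/-- **Rankin's bound with explicit Euler product** (substitute for de Bruijn's `Ψ(x, y)` bound,
McCurley's Lemma 2, at Chebyshev–Mertens quality): for `k ≥ 2` and `0 < η ≤ 1/2`,
`Ψ(N, k) = #{1 ≤ n ≤ N : p ∣ n ⇒ p < k} ≤ N^{1−η} exp(4 (log log k + 4) + 4 η k^η (log k + 2))`.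
[cite: McCurley1986SmallestPrimeValue, Lemma 2 (p. 928)] -/
theorem card_smoothNumbersUpTo_le_rankin_exp (N : ℕ) {k : ℕ} (hk : 2 ≤ k) {η : ℝ} (hη0 : 0 < η)
    (hη : η ≤ 1 / 2) :
    ((Nat.smoothNumbersUpTo N k).card : ℝ) ≤
      (N : ℝ) ^ (1 - η) *
        Real.exp (4 * (Real.log (Real.log k) + 4) + 4 * (η * (k : ℝ) ^ η * (Real.log k + 2))) := by
  have hσ : 0 < 1 - η := by linarith
  have h1 := card_smoothNumbersUpTo_le_rankin N k hσ
  have h2 := prod_primesBelow_inv_one_sub_rpow_le k hη0 hη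
  obtain ⟨h3, h4⟩ := sum_primesBelow_inv_le_and k hk
  have hk0 : (0 : ℝ) < k := by exact_mod_cast (by omega : 0 < k)
  have hcoef : 0 ≤ η * (k : ℝ) ^ η := mul_nonneg hη0.le (Real.rpow_nonneg hk0.le η)
  refine h1.trans (mul_le_mul_of_nonneg_left (h2.trans (Real.exp_le_exp.2 ?_)) (by positivity))
  have := mul_le_mul_of_nonneg_left h4 hcoef
  linarith

end Literature.NumberTheory.Sieve
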